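import Literature.Topology.FourManifolds.OneHandlebodyBoundarySum
import Literature.Topology.FourManifolds.OneHandleAttachmentBoundarySurgery
import Literature.Topology.FourManifolds.BoundaryOrientation
import HarnessLib

/-!
# The one-handle step from the `S⁰`-surgery lemma: `∂(V' ∪ h¹) = ∂V' # (S² × S¹)`

Topic `Literature/Topology/FourManifolds`; assembly companion of `OneHandlebodyBoundarySum.lean`
(whose §3 states the one-handle step `isConnectedSum_boundary_of_isHandleAttachment_one` as a named
fact and whose §4–§5 derive Kirby's sentence `∂(♮ⁿ S¹ × B³) = #ⁿ(S² × S¹)`,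
`exists_oneHandlebody_four_boundary_isSphereTwoProdCircleSum`, from it) and of
`OneHandleAttachmentBoundarySurgery.lean` (piece (1) of the roadmap: attaching one `1`-handle
changes the boundary by a `0`-surgery along a framed `S⁰`,
`IsHandleAttachment.exists_framedSphereFamily_isSurgery_boundary`).

* `isConnectedSum_boundary_of_isHandleAttachment_one_of_zeroSphereSurgery` — **the step follows
  from piece (2) of the roadmap alone**, piece (2) being spelled out as the hypothesis `H2`:
  *`0`-surgery along a framed `S⁰` in a CONNECTED smooth `3`-manifold `Z` with ORIENTABLE result
  `Z₂` is a connected sum `Z # (S² × S¹)`* (`FramedSphereFamily (𝓡 3) Z Unit 0 3`,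
  `FramedSphereFamily.IsSurgery`, `IsConnectedSum (𝓡 3) (𝓡 3) ((𝓡 2).prod (𝓡 1)) Z (S² × S¹) Z₂`;
  Kosinski 1993, VI §9 with (6.6) and (3.1); the orientability of the result excludes the twisted
  bundle `S² ×~ S¹`).  Proof: piece (1) gives the framed `S⁰` in `∂V'` and the surgery
  presentation of `∂V`; `∂V` is orientable as the boundary of the orientable `V`
  (`BoundaryData.isOrientable_carrier`, Hirsch 1976, §4.4); `∂V'` is connected by hypothesis.
* `exists_oneHandlebody_four_boundary_isSphereTwoProdCircleSum_of_zeroSphereSurgery` — hence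
  Kirby's sentence from piece (2) (`…_of_step`).

Everything here is proved; no definitions and no named facts are introduced (piece (2) is a
HYPOTHESIS of both theorems, to be discharged by `ZeroSphereSurgeryConnectedSum.lean`).

## References

* A. A. Kosinski, *Differential Manifolds* (1993), VI (3.1), (6.6), §9. [Kosinski1993]
* R. C. Kirby, *The topology of 4-manifolds*, LNM 1374 (1989), Ch. I §2, p. 8. [Kirby1989]
* M. W. Hirsch, *Differential Topology* (1976), §4.4, p. 103. [HirschDT1976]
* J. Milnor, *Lectures on the h-cobordism theorem* (1965), Thm. 3.13. [MilnorHCobordism1965]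
-/

open scoped Manifold ContDiff Topology
open Set Function

noncomputable section

namespace Literature.Topology.FourManifolds

/-- **The one-handle step from the `S⁰`-surgery lemma.**  If `0`-surgery along a framed `S⁰` in a
connected smooth `3`-manifold with orientable result is always a connected sum with `S² × S¹`
(hypothesis `H2`, piece (2) of the roadmap of `OneHandlebodyBoundarySum.lean`), then attaching one
`1`-handle to a compact connected `4`-manifold `V'` with connected boundary, with orientable result
`V`, changes the boundary by `∂V = ∂V' # (S² × S¹)` — the named fact
`isConnectedSum_boundary_of_isHandleAttachment_one`: piece (1)
(`IsHandleAttachment.exists_framedSphereFamily_isSurgery_boundary`) presents `∂V` as the `0`-surgery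
of `∂V'` along a framed `S⁰`, and `∂V` is orientable (`BoundaryData.isOrientable_carrier`).
[cite: Kosinski1993, VI §9 and (6.6)] [cite: Kirby1989, Ch. I §2 (p. 8)] -/
theorem isConnectedSum_boundary_of_isHandleAttachment_one_of_zeroSphereSurgery
    (H2 : ∀ (Z : Type) [TopologicalSpace Z] [T2Space Z] [ConnectedSpace Z]
      [ChartedSpace (EuclideanSpace ℝ (Fin 3)) Z] [IsManifold (𝓡 3) ∞ Z]
      (νS : FramedSphereFamily (𝓡 3) Z Unit 0 3)
      (Z₂ : Type) [TopologicalSpace Z₂] [T2Space Z₂] [ChartedSpace (EuclideanSpace ℝ (Fin 3)) Z₂]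
      [IsManifold (𝓡 3) ∞ Z₂],
      νS.IsSurgery (𝓡 3) Z₂ → IsOrientable (𝓡 3) Z₂ →
        IsConnectedSum (𝓡 3) (𝓡 3) ((𝓡 2).prod (𝓡 1)) Z
          ((Metric.sphere (0 : EuclideanSpace ℝ (Fin 3)) 1) × (Metric.sphere (0 : EuclideanSpace ℝ (Fin 2)) 1)) Z₂) :
    isConnectedSum_boundary_of_isHandleAttachment_one := by
  intro V' _ _ _ _ _ _ _ V _ _ _ _ _ _ _ hatt ho hconn
  haveI : ConnectedSpace ((𝓡∂ (3 + 1)).boundary V') := isConnected_iff_connectedSpace.1 hconn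
  obtain ⟨νS, hS⟩ := hatt.exists_framedSphereFamily_isSurgery_boundary
  have hoB : IsOrientable (𝓡 3) ((𝓡∂ (3 + 1)).boundary V) :=
    (BoundaryManifold.boundaryData 3 V).isOrientable_carrier ho
  exact H2 _ νS _ hS hoB

/-- **Kirby's sentence `∂(♮ⁿ S¹ × B³) = #ⁿ(S² × S¹)` from the `S⁰`-surgery lemma**: for every `n`
some compact connected orientable `(1,n)`-handlebody has a boundary datum which is `#ⁿ(S² × S¹)`
(`exists_oneHandlebody_four_boundary_isSphereTwoProdCircleSum`), granted piece (2) — through the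
one-handle step (`exists_oneHandlebody_four_boundary_isSphereTwoProdCircleSum_of_step`).
[cite: Kirby1989, Ch. I §2 (p. 8)] [cite: Kosinski1993, VI (11.4)] -/
theorem exists_oneHandlebody_four_boundary_isSphereTwoProdCircleSum_of_zeroSphereSurgery
    (H2 : ∀ (Z : Type) [TopologicalSpace Z] [T2Space Z] [ConnectedSpace Z]
      [ChartedSpace (EuclideanSpace ℝ (Fin 3)) Z] [IsManifold (𝓡 3) ∞ Z]
      (νS : FramedSphereFamily (𝓡 3) Z Unit 0 3)
      (Z₂ : Type) [TopologicalSpace Z₂] [T2Space Z₂] [ChartedSpace (EuclideanSpace ℝ (Fin 3)) Z₂]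
      [IsManifold (𝓡 3) ∞ Z₂],
      νS.IsSurgery (𝓡 3) Z₂ → IsOrientable (𝓡 3) Z₂ →
        IsConnectedSum (𝓡 3) (𝓡 3) ((𝓡 2).prod (𝓡 1)) Z
          ((Metric.sphere (0 : EuclideanSpace ℝ (Fin 3)) 1) × (Metric.sphere (0 : EuclideanSpace ℝ (Fin 2)) 1)) Z₂) :
    exists_oneHandlebody_four_boundary_isSphereTwoProdCircleSum :=
  exists_oneHandlebody_four_boundary_isSphereTwoProdCircleSum_of_step
    (isConnectedSum_boundary_of_isHandleAttachment_one_of_zeroSphereSurgery H2)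

end Literature.Topology.FourManifolds
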